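import Mathlib
import HarnessLib.Audit
import Summits.PneNP.PneNP.Theorems.PstarGateU2Joins
import Summits.PneNP.PneNP.Theorems.PstarGateU2Off
import Summits.PneNP.PneNP.Theorems.PstarGateForest
import Summits.PneNP.PneNP.Theorems.PstarGateFibreRank

/-!
# One GATED chord, node N5, branch (B): trivial corner factors force an ON/ON point on the gate chamber at every common tree edge (E2; prover-1 g19)

FRONTIER range-avoidance ladder, rung F-N3 (`stmt-PneNP-19007`), cell `pnp-ideate` (`PstarGateNodesX.GateU2X`); restricted-model proof complexity —
nothing here bears on `P` versus `NP`.

Branch (B) of `PstarGateU2Corner.u2_corner_cases`: each companion factor `q̃_m` (`m ∈ {r, r'}`, the two reads of `e'`) is `≡ 1` or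
`= P' := Q_{D e'} + γ' + 1`; write `q̃_m = θ_m P' + θ_m + 1`.  Then the joins of the `D e'`-edges follow the polar forms
(`ω(τ_j, m) = θ_m`, `PstarChordBridgeCorner.omega_tau_of_polar`), the OFF-region equation of `PstarGateU2Off.u2_off` at a chamber point with
`u_e = 0` (`exists_off_on_chamber`) reads `r'₂ θ_r + r₂ θ_{r'} = 1`, and (M0) at a tree edge `j ∈ D e ∩ D e'` in defect form
(`PstarGateForest.gate_forest_minimality`, both chords flipped) gives states `p₂ = θ_r P' + 1 + r₂ ℓ (1 + x_p)`, `p₁ = θ_{r'} P' + 1 + r'₂ ℓ (1 + x_p)`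
with `p₁ p₂ = P'`, `x_p x_{p'} = u_e + 1` — solvable only with `ℓ = 1`, `x_p = 0`, `u_e = 1`, `P' = 0`:

* `exists_off_on_chamber` — the gated chord is killable somewhere on each chamber (`avoid ≠ ∅`);
* `u2_branchB_point` — **in branch (B), every common tree edge `j ∈ D e ∩ D e'` yields a chamber point with `u_e = u_{e'} = 1`.**
-/

set_option linter.dupNamespace false -- `Summit.PneNP.PneNP.…`: summit = sub-problem name (D-0017 single-conjunct layout)

open Finset Module Literature.Computability.Complexity
open Summit.PneNP.PneNP.Theorems.PstarFibrePolys (bit)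
open Summit.PneNP.PneNP.Theorems.PstarTyped (Typed)
open Summit.PneNP.PneNP.Theorems.PstarSALevel (BoundaryExpanding SimpleOverlap)
open Summit.PneNP.PneNP.Theorems.PstarXCore (xverts)
open Summit.PneNP.PneNP.Theorems.PstarForcing (polar_unique)
open Summit.PneNP.PneNP.Theorems.PstarProductRank (qform polar)
open Summit.PneNP.PneNP.Theorems.PstarPathRank (polar_basis)
open Summit.PneNP.PneNP.Theorems.PstarPathRankFibre (avoid)
open Summit.PneNP.PneNP.Theorems.PstarReadSumset (V2)
open Summit.PneNP.PneNP.Theorems.PstarChordSystem (ChordSystem)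
open Summit.PneNP.PneNP.Theorems.PstarChordSystemMap (omega)
open Summit.PneNP.PneNP.Theorems.PstarChordBridgeTools (privs coef vars_mem_privs)
open Summit.PneNP.PneNP.Theorems.PstarChordBridge (BridgeData sys Solution Lift)
open Summit.PneNP.PneNP.Theorems.PstarChordBridgeForcing (gam sys_u_eq qform_add')
open Summit.PneNP.PneNP.Theorems.PstarChordBridgeBasis (qDir polarDir)
open Summit.PneNP.PneNP.Theorems.PstarChordBridgeCorner (qDir_add decomp_V2 omega_F omega_add_left omega_basis omega_smul andAdj_iff_mem
  omega_tau_of_polar polar_empty)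
open Summit.PneNP.PneNP.Theorems.PstarChordBridgeForest (defect_eq_one)
open Summit.PneNP.PneNP.Theorems.PstarGateBridge (GateHyp const_of_others gate_reads)
open Summit.PneNP.PneNP.Theorems.PstarGateCompanion
open Summit.PneNP.PneNP.Theorems.PstarGateForest (gate_forest_minimality)
open Summit.PneNP.PneNP.Theorems.PstarGateFibreRank (avoid_nonempty)
open Summit.PneNP.PneNP.Theorems.PstarGateNodes (GateData)
open Summit.PneNP.PneNP.Theorems.PstarGateNodesX (GateDataX)
open Summit.PneNP.PneNP.Theorems.PstarGateU2Corner (qDir_companion_dir)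
open Summit.PneNP.PneNP.Theorems.PstarGateU2Off (u2_off)
open Summit.PneNP.PneNP.Theorems.PstarGateU2Joins (polarDir_companion_dir)

namespace Summit.PneNP.PneNP.Theorems.PstarGateU2BranchB

variable {n m : ℕ}

/-- `qDir` is linear in the direction (pointwise). -/
theorem qDir_lin (I : LocalMap 4 n m) (B : BridgeData n m) (a b : ZMod 2) (v w : V2) (x : Fin n → ZMod 2) :
    qDir I B (a • v + b • w) x = a * qDir I B v x + b * qDir I B w x := by
  unfold PstarChordBridgeBasis.qDir
  simp only [Prod.smul_fst, Prod.smul_snd, Prod.fst_add, Prod.snd_add, smul_eq_mul]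
  ring

/-- **The gated chord is killable somewhere on each chamber**: `∃ x`, `x_u = c`, `u_e(x) = 0` (some edge of `D e` avoids `u`). -/
theorem exists_off_on_chamber (I : LocalMap 4 n m) (hI : I.IsPure xorAndPred) (hS : SimpleOverlap I) {B : BridgeData n m} (hW : B.WF I)
    {e : Fin m} (he : e ∈ B.N) (u : Fin n) (c : ZMod 2) : ∃ x : Fin n → ZMod 2, x u = c ∧ (sys I B).u e x = 0 := by
  classical
  have heD : e ∉ B.D e := fun h => (mem_sdiff.1 (hW.hD e he h)).2 he
  obtain ⟨j, hj⟩ := avoid_nonempty I hI hS heD (hW.hDeven e he) u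
  unfold PstarPathRankFibre.avoid at hj
  obtain ⟨hjD, ha, hb⟩ := mem_filter.1 hj
  rw [mem_singleton] at ha hb
  by_contra hno
  push Not at hno
  set x₁ : Fin n → ZMod 2 := Pi.single u c with hx₁
  set ea : Fin n → ZMod 2 := Pi.single (I.vars j 2) 1 with hea
  set eb : Fin n → ZMod 2 := Pi.single (I.vars j 3) 1 with heb
  have hone : ∀ x : Fin n → ZMod 2, x u = c → (sys I B).u e x = 1 := by
    intro x hx
    have z01 : ∀ t : ZMod 2, t ≠ 0 → t = 1 := by decide
    exact z01 _ (hno x hx)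
  have hx₁u : x₁ u = c := by rw [hx₁, Pi.single_eq_same]
  have heau : ea u = 0 := by rw [hea, Pi.single_eq_of_ne (Ne.symm ha)]
  have hebu : eb u = 0 := by rw [heb, Pi.single_eq_of_ne (Ne.symm hb)]
  have h1 := hone x₁ hx₁u
  have h2 := hone (x₁ + ea) (by rw [Pi.add_apply, hx₁u, heau, add_zero])
  have h3 := hone (x₁ + eb) (by rw [Pi.add_apply, hx₁u, hebu, add_zero])
  have h4 := hone (x₁ + (ea + eb)) (by rw [Pi.add_apply, Pi.add_apply, hx₁u, heau, hebu, add_zero, add_zero])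
  rw [sys_u_eq] at h1 h2 h3 h4
  have hQ := qform_add' I (B.D e)
  have hab : polar (B.D e) (fun j => I.vars j 2) (fun j => I.vars j 3) ea eb = 1 := by
    rw [hea, heb, polar_basis I hI hS, if_pos ((andAdj_iff_mem I hI hS (B.D e) j).2 hjD)]
  have hlin : polar (B.D e) (fun j => I.vars j 2) (fun j => I.vars j 3) (x₁ + ea) eb =
      polar (B.D e) (fun j => I.vars j 2) (fun j => I.vars j 3) x₁ eb + 1 := by
    rw [map_add, LinearMap.add_apply, hab]
  have k3 := hQ x₁ eb
  have k4 := hQ (x₁ + ea) eb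
  rw [hlin] at k4
  rw [← add_assoc, k4] at h4
  rw [k3] at h3
  have hs0 : qform (B.D e) (fun j => I.vars j 2) (fun j => I.vars j 3) eb + qform (B.D e) (fun j => I.vars j 2) (fun j => I.vars j 3) 0 +
      polar (B.D e) (fun j => I.vars j 2) (fun j => I.vars j 3) x₁ eb = 0 := by linear_combination h3 - h1
  have hs1 : qform (B.D e) (fun j => I.vars j 2) (fun j => I.vars j 3) eb + qform (B.D e) (fun j => I.vars j 2) (fun j => I.vars j 3) 0 +
      polar (B.D e) (fun j => I.vars j 2) (fun j => I.vars j 3) x₁ eb + 1 = 0 := by linear_combination h4 - h2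
  have h10 : (1 : ZMod 2) = 0 := by linear_combination hs1 - hs0
  exact one_ne_zero h10

/-- The pure finite check behind `u2_branchB_point`. -/
private theorem branchB_aux : ∀ (θr θr' r₂ r'₂ P l a : ZMod 2), r'₂ * θr + r₂ * θr' = 1 →
    (θr' * P + θr' + 1 + r'₂ * l + a * (l * r'₂) + θr') * (θr * P + θr + 1 + r₂ * l + a * (l * r₂) + θr) = P →
    l = 1 ∧ a = 0 ∧ P = 0 := by
  decide

/-- **Branch (B): an ON/ON chamber point at every common tree edge.**  See the module docstring. -/
theorem u2_branchB_point (I : LocalMap 4 n m) (hI : I.IsPure xorAndPred) (hT : Typed I) (hS : SimpleOverlap I) {r₀ : ℕ}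
    {B : BridgeData n m} {e g₀ : Fin m} {u : Fin n} {κ₀ : ZMod 2} (hD : GateDataX I r₀ B e g₀ u κ₀)
    {e' : Fin m} (hN : B.N = {e, e'}) (hne : e' ≠ e)
    (hU2 : ∀ a, (sys I B).ρ e' a ≠ 0 ∧ (sys I B).ρ' e' a ≠ 0 ∧ (sys I B).ρ e' a ≠ (sys I B).ρ' e' a)
    (hBr : ∀ mv : V2, (mv = (sys I B).ρ e' 0 ∨ mv = (sys I B).ρ' e' 0) →
      (∀ x, qDir I (companion I B e g₀ u (decide (I.vars e 2 ∈ B.C₁))) mv x = 1) ∨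
      (∀ x, qDir I (companion I B e g₀ u (decide (I.vars e 2 ∈ B.C₁))) mv x =
        qform (B.D e') (fun j => I.vars j 2) (fun j => I.vars j 3) x + gam B e' + 1))
    {j : Fin m} (hjD : j ∈ B.D e) (hjD' : j ∈ B.D e') :
    ∃ x : Fin n → ZMod 2, x u = κ₀ + 1 ∧ (sys I B).u e x = 1 ∧ (sys I B).u e' x = 1 := by
  classical
  obtain ⟨-, hW, hr, hd₁, hd₂, hL, -, -, hG, hg₀, hgv, -, hup, hux, hG₁p, hcoef, hT3, hM0⟩ := id hD
  set B₀ := companion I B e g₀ u (decide (I.vars e 2 ∈ B.C₁)) with hB₀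
  set Q' : (Fin n → ZMod 2) → ZMod 2 := qform (B.D e') (fun j => I.vars j 2) (fun j => I.vars j 3) with hQ'
  have he : e ∈ B.N := hG.1
  have he' : e' ∈ B.N := by rw [hN]; exact mem_insert_of_mem (mem_singleton_self _)
  have hjJ : j ∈ B.J₀ := (mem_sdiff.1 (hW.hD e he hjD)).1
  set r : V2 := (sys I B).ρ e' 0 with hrdef
  set r' : V2 := (sys I B).ρ' e' 0 with hr'def
  obtain ⟨hr0, hr'0, hrr'⟩ := hU2 0
  have hρx : ∀ x, (sys I B).ρ e' x = r ∧ (sys I B).ρ' e' x = r' := fun x => const_of_others I hW hG e' he' hne x 0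
  have hqt : ∀ mv x, qDir I B₀ mv x = qDir I B mv x + mv.2 * coef I B.C₁ B.G₁ (I.vars e 2) x :=
    fun mv x => qDir_companion_dir I hI hW hG hg₀ hgv hup hux hG₁p mv x
  have hpolc : ∀ mv, polarDir I B₀ mv = polarDir I B mv := fun mv => polarDir_companion_dir I hI hW hG hg₀ hgv hup hux hG₁p ⟨κ₀, hcoef⟩ mv
  -- each direction: `q̃_m = θ P' + θ + 1` and `ω(τ_k, m) = θ [k ∈ D e']` on the core
  have hdir : ∀ mv : V2, (mv = r ∨ mv = r') → ∃ θ : ZMod 2, (∀ x, qDir I B₀ mv x = θ * (Q' x + gam B e' + 1) + θ + 1) ∧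
      ∀ k ∈ B.J₀, omega ((if k ∈ B.T₁ then 1 else 0), (if k ∈ B.T₂ then 1 else 0)) mv = θ * (if k ∈ B.D e' then 1 else 0) := by
    intro mv hmv
    have hqB₀ := qDir_add I B₀ mv
    rcases hBr mv hmv with h1 | hP
    · refine ⟨0, fun x => by rw [h1 x, zero_mul, zero_add, zero_add], fun k hk => ?_⟩
      have hpol0 : polarDir I B mv = polar (∅ : Finset (Fin m)) (fun j => I.vars j 2) (fun j => I.vars j 3) := by
        rw [polar_empty, ← hpolc mv]
        refine polar_unique hqB₀ (fun x w => ?_)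
        rw [h1, h1, h1, h1, LinearMap.zero_apply, LinearMap.zero_apply]; decide
      rw [omega_tau_of_polar I hI hS B hd₁.symm hd₂.symm hpol0 hk, zero_mul]
      simp
    · refine ⟨1, fun x => ?_, fun k hk => ?_⟩
      · rw [hP x, one_mul]
        have e2 : ∀ a g : ZMod 2, a + g + 1 = a + g + 1 + 1 + 1 := by decide
        exact e2 _ _
      have hQB : ∀ x w, Q' (x + w) = Q' x + Q' w + Q' 0 + polar (B.D e') (fun j => I.vars j 2) (fun j => I.vars j 3) x w :=
        qform_add' I (B.D e')
      have hpol1 : polarDir I B mv = polar (B.D e') (fun j => I.vars j 2) (fun j => I.vars j 3) := by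
        rw [← hpolc mv]
        refine polar_unique hqB₀ (fun x w => ?_)
        rw [hP, hP, hP, hP, hQB x w]
        generalize Q' x = a; generalize Q' w = b; generalize Q' 0 = c; generalize gam B e' = g
        generalize polar (B.D e') (fun j => I.vars j 2) (fun j => I.vars j 3) x w = s
        revert a b c g s; decide
      rw [omega_tau_of_polar I hI hS B hd₁.symm hd₂.symm hpol1 hk, one_mul]
  obtain ⟨θr, hθr, hωr⟩ := hdir r (Or.inl rfl)
  obtain ⟨θr', hθr', hωr'⟩ := hdir r' (Or.inr rfl)
  -- (*) `r'₂ θ_r + r₂ θ_{r'} = 1`, from the OFF-region equation at a chamber point with `u_e = 0`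
  obtain ⟨x₀, hx₀u, hx₀e⟩ := exists_off_on_chamber I hI hS hW he u (κ₀ + 1)
  have hc₀ : coef I B.C₁ B.G₁ (I.vars e 2) x₀ = 1 := by
    rw [hcoef, hx₀u]
    have e2 : ∀ k : ZMod 2, k + (k + 1) = 1 := by decide
    exact e2 κ₀
  obtain ⟨hu'₀, hq₀⟩ := u2_off I hI hT hD hN hne hU2 hc₀ hx₀e
  have hP'₀ : Q' x₀ + gam B e' + 1 = 0 := by
    have h := hu'₀
    rw [sys_u_eq] at h
    have e2 : ∀ g Q : ZMod 2, g + Q = 1 → Q + g + 1 = 0 := by decide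
    exact e2 _ _ h
  have hω1 : omega (1, 0) r' = r'.2 := by unfold omega; simp
  have hω2 : omega (1, 0) r = r.2 := by unfold omega; simp
  have hstar : r'.2 * θr + r.2 * θr' = 1 := by
    have h10 : qDir I B (1, 0) x₀ = qDir I B₀ (1, 0) x₀ := by rw [hqt]; simp
    have hdec : qDir I B₀ (1, 0) x₀ = r'.2 * qDir I B₀ r x₀ + r.2 * qDir I B₀ r' x₀ := by
      conv_lhs => rw [decomp_V2 hr0 hr'0 hrr' (1, 0)]
      rw [qDir_lin, hω1, hω2]
    have h := hq₀
    rw [h10, hdec, hθr x₀, hθr' x₀, hP'₀, mul_zero, mul_zero, zero_add, zero_add] at h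
    have e3 : ∀ a b t t' : ZMod 2, a * (t + 1) + b * (t' + 1) = b + a + 1 → a * t + b * t' = 1 := by decide
    exact e3 _ _ _ _ h
  -- (M0) at `j`, defect form, both chords flipped
  obtain ⟨z, hz⟩ := hM0 j hjJ
  have hpp' : I.vars e 2 ≠ I.vars e 3 := fun h => absurd (hI.2 e h) (by decide)
  have hp'priv : I.vars e 3 ∈ privs I B.N := vars_mem_privs I he (s := 3) (by decide)
  obtain ⟨hunG₁, hunG₂⟩ := hG.2.1 _ hp'priv (Ne.symm hpp')
  have hG₁'' : ∀ g ∈ B.G₁.erase g₀, I.vars g 2 ≠ I.vars e 2 ∧ I.vars g 2 ≠ I.vars e 3 ∧ I.vars g 3 ≠ I.vars e 2 ∧ I.vars g 3 ≠ I.vars e 3 :=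
    fun g hg => ⟨(hG₁p g hg).1, (hunG₁ g (mem_of_mem_erase hg)).1, (hG₁p g hg).2, (hunG₁ g (mem_of_mem_erase hg)).2⟩
  have hG₂'' : ∀ g ∈ B.G₂, I.vars g 2 ≠ I.vars e 2 ∧ I.vars g 2 ≠ I.vars e 3 ∧ I.vars g 3 ≠ I.vars e 2 ∧ I.vars g 3 ≠ I.vars e 3 :=
    fun g hg => ⟨(hG.2.2.1 g hg).1, (hunG₂ g hg).1, (hG.2.2.1 g hg).2, (hunG₂ g hg).2⟩
  obtain ⟨hchord, hval⟩ := gate_forest_minimality I hI hT hW he hjD hg₀ hgv hup hG₁'' hG₂'' hz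
  have hδ := defect_eq_one I hI hW he hjD hT3 hz
  set x : Fin n → ZMod 2 := fun v => bit (z v) with hxdef
  have hpp : bit (z (I.vars e' 2)) * bit (z (I.vars e' 3)) = Q' x + gam B e' + 1 := by
    have h := hchord e' he' hne
    rw [if_pos hjD', hδ, sys_u_eq] at h
    rw [h]; abel
  rw [hδ] at hval
  obtain ⟨hωrr, hωr'r', hωrr', hωr'r⟩ := omega_basis hr0 hr'0 hrr'
  have hval' : (sys I B).F x + (sys I B).t =
      bit (z (I.vars e 2)) • ((coef I B.C₁ B.G₁ (I.vars e 2) x, 0) : V2) + bit (z (I.vars e' 2)) • r + bit (z (I.vars e' 3)) • r' +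
        ((if j ∈ B.T₁ then 1 else 0), (if j ∈ B.T₂ then 1 else 0)) := by
    unfold ChordSystem.val ChordSystem.contrib at hval
    rw [hN, sum_pair (Ne.symm hne), (gate_reads I hI hG x).1, (gate_reads I hI hG x).2, (hρx x).1, (hρx x).2, smul_zero, add_zero] at hval
    have e2 : ∀ F T a c d τ : V2, F + (a + (c + d)) = T + τ → F + T = a + c + d + τ := by decide
    exact e2 _ _ _ _ _ _ hval
  have hωℓ : ∀ mv : V2, omega ((coef I B.C₁ B.G₁ (I.vars e 2) x, 0) : V2) mv = coef I B.C₁ B.G₁ (I.vars e 2) x * mv.2 := by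
    intro mv; unfold omega; simp
  have hp₂ : bit (z (I.vars e' 3)) = qDir I B r x + bit (z (I.vars e 2)) * (coef I B.C₁ B.G₁ (I.vars e 2) x * r.2) + θr := by
    have h := congrArg (fun v => omega v r) hval'
    rw [omega_F, omega_add_left, omega_add_left, omega_add_left, omega_smul, omega_smul, omega_smul, hωℓ, hωrr, hωr'r, hωr j hjJ,
      if_pos hjD', mul_zero, add_zero, mul_one, mul_one] at h
    have e3 : ∀ q a p t : ZMod 2, q = a + p + t → p = q + a + t := by decide
    exact e3 _ _ _ _ h
  have hp₁ : bit (z (I.vars e' 2)) = qDir I B r' x + bit (z (I.vars e 2)) * (coef I B.C₁ B.G₁ (I.vars e 2) x * r'.2) + θr' := by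
    have h := congrArg (fun v => omega v r') hval'
    rw [omega_F, omega_add_left, omega_add_left, omega_add_left, omega_smul, omega_smul, omega_smul, hωℓ, hωrr', hωr'r', hωr' j hjJ,
      if_pos hjD', mul_one, mul_zero, add_zero, mul_one] at h
    have e3 : ∀ q a p t : ZMod 2, q = a + p + t → p = q + a + t := by decide
    exact e3 _ _ _ _ h
  -- `q_m = q̃_m + m₂ ℓ`
  have hqq : ∀ mv, qDir I B mv x = qDir I B₀ mv x + mv.2 * coef I B.C₁ B.G₁ (I.vars e 2) x := by
    intro mv
    rw [hqt]
    have e2 : ∀ a b : ZMod 2, a = a + b + b := by decide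
    exact e2 _ _
  rw [hqq r, hθr x] at hp₂
  rw [hqq r', hθr' x] at hp₁
  have hab : bit (z (I.vars e 2)) * bit (z (I.vars e 3)) = (sys I B).u e x + 1 := by
    have e2 : ∀ U c : ZMod 2, U + c = 1 → c = U + 1 := by decide
    exact e2 _ _ hδ
  rw [hp₁, hp₂] at hpp
  obtain ⟨hl, ha, hP⟩ := branchB_aux θr θr' r.2 r'.2 _ _ _ hstar hpp
  refine ⟨x, ?_, ?_, ?_⟩
  · have h := hl
    rw [hcoef] at h
    have e2 : ∀ k c : ZMod 2, k + c = 1 → c = k + 1 := by decide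
    exact e2 _ _ h
  · rw [ha, zero_mul] at hab
    have e2 : ∀ U : ZMod 2, 0 = U + 1 → U = 1 := by decide
    exact e2 _ hab
  · rw [sys_u_eq]
    have e2 : ∀ Q g : ZMod 2, Q + g + 1 = 0 → g + Q = 1 := by decide
    exact e2 _ _ hP

end Summit.PneNP.PneNP.Theorems.PstarGateU2BranchB
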